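import Mathlib
import Summits.Ventures.PercRepro2.Defs
import Summits.Ventures.PercRepro2.Independence
import Summits.Ventures.PercRepro2.Harris
import Summits.Ventures.PercRepro2.Graph
import Summits.Ventures.PercRepro2.Exploration
import Summits.Ventures.PercRepro2.Events
import Summits.Ventures.PercRepro2.FourFunctions
import Summits.Ventures.PercRepro2.Induced
import Summits.Ventures.PercRepro2.Frontier
import Summits.Ventures.PercRepro2.ObsIndependence
import Summits.Ventures.PercRepro2.BHK
import Summits.Ventures.PercRepro2.BHKEvents
import Summits.Ventures.PercRepro2.BHKAvoid
import Summits.Ventures.PercRepro2.SameClusterAvoid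
import Summits.Ventures.PercRepro2.CaseOneRegime
import Summits.Ventures.PercRepro2.CaseOnePos
import Summits.Ventures.PercRepro2.CaseOneJ11
import Summits.Ventures.PercRepro2.CaseOneRV
import Summits.Ventures.PercRepro2.PathMixBHK
import Summits.Ventures.PercRepro2.CylinderCond
import Summits.Ventures.PercRepro2.CylinderCov
import Summits.Ventures.PercRepro2.PathMixKernel

/-!
# The (i)-side of PATHMIX in the kernel: `PM₁ ≥ 0 ⟹ (i)`, hence `PM₁ ≥ 0 ∧ PM ≥ 0 ⟹ (J1₁)`
(blind cell PercRepro2, p1 g13; lead g24 00:04Z «E₁ = E¹[Cov(1[b∈C₁], 1[o∈C₂] ∣ T)] − PM₁, PM₁ ≥ 0 ⟹ (i)»)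

Same objects as `PathMixKernel.lean` with the `b ∈ C₁` masses `x'_T = P_{p_T}(b ∈ C₁, Q)`,
`z'_T = P_{p_T}(b ∈ C₁, o ∈ C₂, Q)` (`recXL`, `recZL`): the within-record covariance is now `≤ 0`
(`givenT_cross_cluster`, **`withinL_nonpos`**), **`pm1Expr := Σ_T w_T (x'_T / m_T − P_Q(b ∈ C₁)) (γ − y_T / m_T)`**
is the lead's PM₁ = p1's `(PATH_{1_b})`, and **`zSplitI_of_pm1`**: `0 ≤ pm1Expr ⟹ (i)` — the
algebra is `pm_algebra` applied to the NEGATED `b ∈ C₁` masses (the cross-cluster sign flips the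
inequality). With `zSplitII_of_pm`: **`jOneOne_of_pm1_of_pm`**: `PM₁ ≥ 0 ∧ PM ≥ 0 ⟹ (J1₁)`. Census of
both (p1's DFS records): the exhaustive bar, 0 / 23,463,168 per palette. Nothing beyond is claimed. -/

namespace Summit.Ventures.PercRepro2

namespace PathMix

open CylinderCond CylinderCov

section Kernel
variable {V : Type*} {E : Type*} [Fintype E] [DecidableEq E] [Fintype V] [DecidableEq V]
  {R : Type*} [Field R] [LinearOrder R] [IsStrictOrderedRing R]
variable {ι : Type*}

/-- `x'_T = P_{p_T}(b ∈ C₁, Q)`. -/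
noncomputable def recXL (p : E → R) (ends : E → Sym2 V) (a₁ a₂ b : V) (F : ι → Finset E)
    (σ : ι → Config E) (T : ι) : R :=
  expect (condWeights p (F T) (σ T))
    (fun ω => (connEvent ends a₁ b).indicator 1 ω * ((connEvent ends a₁ a₂)ᶜ).indicator 1 ω)

/-- `z'_T = P_{p_T}(b ∈ C₁, o ∈ C₂, Q)`. -/
noncomputable def recZL (p : E → R) (ends : E → Sym2 V) (o a₁ a₂ b : V) (F : ι → Finset E)
    (σ : ι → Config E) (T : ι) : R :=
  expect (condWeights p (F T) (σ T))
    (fun ω => (connEvent ends a₁ b).indicator 1 ω * (connEvent ends a₂ o).indicator 1 ω *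
      ((connEvent ends a₁ a₂)ᶜ).indicator 1 ω)

/-- **The lead's PM₁** (= p1's `(PATH_{1_b})`) for a family of records:
`Σ_T w_T · (x'_T / m_T − P_Q(b ∈ C₁)) · (γ − y_T / m_T)`. -/
noncomputable def pm1Expr (p : E → R) (ends : E → Sym2 V) (o a₁ a₂ a₃ b : V) (s : Finset ι)
    (F : ι → Finset E) (σ : ι → Config E) : R :=
  ∑ T ∈ s, (recC p F σ T * recM p ends a₁ a₂ F σ T /
      ∑ T' ∈ s, recC p F σ T' * recM p ends a₁ a₂ F σ T') *
    (recXL p ends a₁ a₂ b F σ T / recM p ends a₁ a₂ F σ T -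
      prob p (connEvent ends a₁ b ∩ (connEvent ends a₁ a₂)ᶜ) / prob p (connEvent ends a₁ a₂)ᶜ) *
    (CaseOne.Dpdo p ends o a₁ a₂ a₃ / CaseOne.Dpd p ends a₁ a₂ a₃ -
      recX p ends a₁ a₂ o F σ T / recM p ends a₁ a₂ F σ T)

/-- **The within-record cross covariance is nonpositive** (`z'_T m_T ≤ x'_T y_T`,
`givenT_cross_cluster` at the record's weights). -/
theorem withinL_nonpos (p : E → R) (hp : IsProbVec p) (ends : E → Sym2 V) (o a₁ a₂ b : V)
    (F : ι → Finset E) (σ : ι → Config E) (T : ι) :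
    recZL p ends o a₁ a₂ b F σ T * recM p ends a₁ a₂ F σ T ≤
      recXL p ends a₁ a₂ b F σ T * recX p ends a₁ a₂ o F σ T := by
  have h := givenT_cross_cluster p hp ends o a₁ a₂ b (F T |>.filter fun e => σ T e = true)
    (F T |>.filter fun e => σ T e = false)
  rw [← condWeights_eq_modWeights] at h
  unfold recXL recZL recX recM
  rw [CaseOne.expect_ind2, CaseOne.expect_ind2, CaseOne.expect_ind3, ← prob_eq_expect_indicator]
  exact h

omit [Fintype V] [DecidableEq V] [LinearOrder R] [IsStrictOrderedRing R] in
/-- `SX' = P(b ∈ C₁, Q, a₃ ∈ C₁)`. -/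
theorem sum_recCXL (p : E → R) (ends : E → Sym2 V) (a₁ a₂ a₃ b : V) {s : Finset ι}
    {F : ι → Finset E} {σ : ι → Config E} (h : IsCylinderPartition s F σ (connEvent ends a₁ a₃)) :
    ∑ T ∈ s, recC p F σ T * recXL p ends a₁ a₂ b F σ T =
      expect p (fun ω => ((connEvent ends a₁ b).indicator 1 ω *
        ((connEvent ends a₁ a₂)ᶜ).indicator 1 ω) * (connEvent ends a₁ a₃).indicator 1 ω) := by
  rw [expect_mul_indicator_eq_sum p h]
  rfl

omit [Fintype V] [DecidableEq V] [LinearOrder R] [IsStrictOrderedRing R] in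
/-- `SZ' = P(b ∈ C₁, o ∈ C₂, Q, a₃ ∈ C₁)`. -/
theorem sum_recCZL (p : E → R) (ends : E → Sym2 V) (o a₁ a₂ a₃ b : V) {s : Finset ι}
    {F : ι → Finset E} {σ : ι → Config E} (h : IsCylinderPartition s F σ (connEvent ends a₁ a₃)) :
    ∑ T ∈ s, recC p F σ T * recZL p ends o a₁ a₂ b F σ T =
      expect p (fun ω => ((connEvent ends a₁ b).indicator 1 ω * (connEvent ends a₂ o).indicator 1 ω *
        ((connEvent ends a₁ a₂)ᶜ).indicator 1 ω) * (connEvent ends a₁ a₃).indicator 1 ω) := by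
  rw [expect_mul_indicator_eq_sum p h]
  rfl

omit [Fintype V] [DecidableEq V] [LinearOrder R] [IsStrictOrderedRing R] in
/-- **`iExpr` in the disintegrated masses**:
`iExpr = −[Q₀ · (D · SZ' − D_o · SX') − P(b ∈ C₁, Q) · (D · SY − D_o · M)]`. -/
theorem iExpr_eq_sums (p : E → R) (ends : E → Sym2 V) (o a₁ a₂ a₃ b : V) {s : Finset ι}
    {F : ι → Finset E} {σ : ι → Config E} (h : IsCylinderPartition s F σ (connEvent ends a₁ a₃)) :
    CaseOne.iExpr p ends o a₁ a₂ a₃ b =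
      -(prob p (connEvent ends a₁ a₂)ᶜ *
          (CaseOne.Dpd p ends a₁ a₂ a₃ * (∑ T ∈ s, recC p F σ T * recZL p ends o a₁ a₂ b F σ T) -
            CaseOne.Dpdo p ends o a₁ a₂ a₃ * (∑ T ∈ s, recC p F σ T * recXL p ends a₁ a₂ b F σ T)) -
        prob p (connEvent ends a₁ b ∩ (connEvent ends a₁ a₂)ᶜ) *
          (CaseOne.Dpd p ends a₁ a₂ a₃ * (∑ T ∈ s, recC p F σ T * recX p ends a₁ a₂ o F σ T) -
            CaseOne.Dpdo p ends o a₁ a₂ a₃ * (∑ T ∈ s, recC p F σ T * recM p ends a₁ a₂ F σ T))) := by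
  rw [sum_recCZL p ends o a₁ a₂ a₃ b h, sum_recCXL p ends a₁ a₂ a₃ b h,
    sum_recCX p ends a₁ a₂ a₃ o h, sum_recCM p ends a₁ a₂ a₃ h]
  unfold CaseOne.iExpr CaseOne.zFun
  have e1 : expect p (fun ω => (connEvent ends a₁ b).indicator (1 : Config E → R) ω *
      ((connEvent ends a₁ a₃).indicator 1 ω *
        (CaseOne.Dpd p ends a₁ a₂ a₃ * (connEvent ends a₂ o).indicator 1 ω -
          CaseOne.Dpdo p ends o a₁ a₂ a₃)) * ((connEvent ends a₁ a₂)ᶜ).indicator 1 ω) =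
      CaseOne.Dpd p ends a₁ a₂ a₃ * expect p (fun ω => (connEvent ends a₁ b).indicator 1 ω *
          (connEvent ends a₂ o).indicator 1 ω * ((connEvent ends a₁ a₂)ᶜ).indicator 1 ω *
          (connEvent ends a₁ a₃).indicator 1 ω) -
        CaseOne.Dpdo p ends o a₁ a₂ a₃ * expect p (fun ω => (connEvent ends a₁ b).indicator 1 ω *
          ((connEvent ends a₁ a₂)ᶜ).indicator 1 ω * (connEvent ends a₁ a₃).indicator 1 ω) := by
    rw [← expect_const_mul, ← expect_const_mul, ← expect_sub]
    congr 1
    funext ω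
    simp only [Pi.sub_apply]
    ring
  have e2 : expect p (fun ω => (connEvent ends a₁ a₃).indicator (1 : Config E → R) ω *
      (CaseOne.Dpd p ends a₁ a₂ a₃ * (connEvent ends a₂ o).indicator 1 ω -
        CaseOne.Dpdo p ends o a₁ a₂ a₃) * ((connEvent ends a₁ a₂)ᶜ).indicator 1 ω) =
      CaseOne.Dpd p ends a₁ a₂ a₃ * expect p (fun ω => (connEvent ends a₂ o).indicator 1 ω *
          ((connEvent ends a₁ a₂)ᶜ).indicator 1 ω * (connEvent ends a₁ a₃).indicator 1 ω) -
        CaseOne.Dpdo p ends o a₁ a₂ a₃ * expect p (fun ω => ((connEvent ends a₁ a₂)ᶜ).indicator 1 ω *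
          (connEvent ends a₁ a₃).indicator 1 ω) := by
    rw [← expect_const_mul, ← expect_const_mul, ← expect_sub]
    congr 1
    funext ω
    simp only [Pi.sub_apply]
    ring
  rw [e1, e2, CaseOne.expect_ind2]

/-- **The (i)-side of PATHMIX in the kernel**: for every cylinder partition of `{a₃ ∈ C₁}` with
`P(Q), D, M > 0`, `0 ≤ pm1Expr ⟹ (i)` (`pm_algebra` on the negated `b ∈ C₁` masses). -/
theorem zSplitI_of_pm1 (p : E → R) (hp : IsProbVec p) (ends : E → Sym2 V) (o a₁ a₂ a₃ b : V)
    {s : Finset ι} {F : ι → Finset E} {σ : ι → Config E}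
    (h : IsCylinderPartition s F σ (connEvent ends a₁ a₃))
    (hQ : 0 < prob p (connEvent ends a₁ a₂)ᶜ) (hD : 0 < CaseOne.Dpd p ends a₁ a₂ a₃)
    (hM : 0 < ∑ T ∈ s, recC p F σ T * recM p ends a₁ a₂ F σ T)
    (hpm : 0 ≤ pm1Expr p ends o a₁ a₂ a₃ b s F σ) :
    CaseOne.ZSplitI p ends o a₁ a₂ a₃ b := by
  unfold CaseOne.ZSplitI
  rw [iExpr_eq_sums p ends o a₁ a₂ a₃ b h]
  -- `pm_algebra` on `x̃ = −x'`, `z̃ = −z'`, `P̃ = −P(b ∈ C₁, Q)`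
  have key := pm_algebra (s := s) (recC p F σ) (recM p ends a₁ a₂ F σ)
    (fun T => -recXL p ends a₁ a₂ b F σ T) (recX p ends a₁ a₂ o F σ)
    (fun T => -recZL p ends o a₁ a₂ b F σ T) (fun T => prob_nonneg hp _)
    (fun T => expect_nonneg (isProbVec_condWeights hp (F T) (σ T)) fun _ =>
      Set.indicator_apply_nonneg fun _ => zero_le_one)
    (fun T hmT => by
      have hq := isProbVec_condWeights hp (F T) (σ T)
      refine ⟨?_, expect_mul_indicator_eq_zero hq _ hmT _, ?_⟩
      · simp only [neg_eq_zero]; exact expect_mul_indicator_eq_zero hq _ hmT _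
      · simp only [neg_eq_zero]
        exact expect_mul_indicator_eq_zero hq ((connEvent ends a₁ a₂)ᶜ) hmT
          (fun ω => (connEvent ends a₁ b).indicator 1 ω * (connEvent ends a₂ o).indicator 1 ω))
    (fun T => by
      have := withinL_nonpos p hp ends o a₁ a₂ b F σ T
      simp only [neg_mul]
      linarith)
    hM (prob p (connEvent ends a₁ a₂)ᶜ) (CaseOne.Dpd p ends a₁ a₂ a₃)
    (CaseOne.Dpdo p ends o a₁ a₂ a₃) (-prob p (connEvent ends a₁ b ∩ (connEvent ends a₁ a₂)ᶜ)) hQ hD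
    (by
      unfold pm1Expr at hpm
      refine le_of_le_of_eq hpm (Finset.sum_congr rfl fun T _ => ?_)
      simp only [neg_div]
      ring)
  simp only [Finset.sum_neg_distrib, mul_neg] at key
  linarith

/-- **`PM₁ ≥ 0 ∧ PM ≥ 0 ⟹ (J1₁)`** for every cylinder partition of `{a₃ ∈ C₁}`. -/
theorem jOneOne_of_pm1_of_pm (p : E → R) (hp : IsProbVec p) (ends : E → Sym2 V) (o a₁ a₂ a₃ b : V)
    {s : Finset ι} {F : ι → Finset E} {σ : ι → Config E}
    (h : IsCylinderPartition s F σ (connEvent ends a₁ a₃))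
    (hQ : 0 < prob p (connEvent ends a₁ a₂)ᶜ) (hD : 0 < CaseOne.Dpd p ends a₁ a₂ a₃)
    (hM : 0 < ∑ T ∈ s, recC p F σ T * recM p ends a₁ a₂ F σ T)
    (hpm1 : 0 ≤ pm1Expr p ends o a₁ a₂ a₃ b s F σ) (hpm : 0 ≤ pmExpr p ends o a₁ a₂ a₃ b s F σ) :
    CaseOne.JOneOne p ends o a₁ a₂ a₃ b :=
  CaseOne.jOneOne_of_i_of_ii p ends o a₁ a₂ a₃ b (zSplitI_of_pm1 p hp ends o a₁ a₂ a₃ b h hQ hD hM hpm1)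
    (zSplitII_of_pm p hp ends o a₁ a₂ a₃ b h hQ hD hM hpm)

end Kernel

end PathMix

end Summit.Ventures.PercRepro2
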